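import Summits.SmoothPoincare4.SmoothPoincare4.Theses.WeylBudget
import Literature.Topology.FourManifolds.CorkDecompositionInvolutive
import Literature.Topology.FourManifolds.CorkDecompositionInvolutiveProofs
import Literature.Topology.FourManifolds.ThetaFourKervaireMilnorFrontier
import Literature.Topology.FourManifolds.Gluing
import Literature.Geometry.Riemannian.BaerHankeMeanCurvatureIncrease
import Literature.Geometry.Riemannian.BaerHankeNormalForm
import Literature.Geometry.Riemannian.BaerHankeNormalFormProofs
import Literature.Geometry.Riemannian.BaerHankeGluing
import Summits.SmoothPoincare4.SmoothPoincare4.Theorems.WeylBudgetCorkRegluablePscStubCorkPresentation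
import Summits.SmoothPoincare4.SmoothPoincare4.Theorems.WeylBudgetCorkRegluablePscStubIsometricRegluing
import Summits.SmoothPoincare4.SmoothPoincare4.Theorems.WeylBudgetCorkRegluablePscStubIsometricTransport
import Summits.SmoothPoincare4.SmoothPoincare4.Theorems.WeylBudgetCorkRegluablePscStubTransportSymmetricGerm
import HarnessLib

/-!
# Line `swap-sum` for crux `WeylBudget.CorkRegluablePsc` (stmt-SmoothPoincare4-3206) — strategist alt line

**Idea (Matveyev's boundary-sum swap, metrised).**  Present `Σ` in MATVEYEV FORM
`S⁴ = W₁ ∪_Y M`, `Σ = W₂ ∪_Y M`, `D(W₁) ≅ S⁴ ≅ W₁ ∪_Y W₂` (`W₁`, `W₂` compact contractible, `M` compact,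
common boundary `Y`; Matveyev 1996 Thm. 1 part 1 + Fact 1 = the tree's `Matveyev1996_partOne_and_fact`).
The involutive cork of Kirby's Addendum (D) is then `C = W₁ ♮ W₂` with exterior `W = M ♮ W₁` and `τ` = the swap
of the two summands of `∂C = Y # Y` (Matveyev p. 3: `M₁ ≅ (M♮W₁) ∪ (W₁♮W₂)`, `M₂ ≅ (M♮W₁) ∪ (W₂♮W₁)`).
THE POINT: if the THREE pieces carry PSC metrics `g₁, g₂, g_M` inducing ONE boundary metric `h` on `Y` with the
four one-sided sign conditions `H₁ + H_M ≥ 0`, `H₂ + H_M ≥ 0`, `H₁ + H₂ ≥ 0`, `H₁ ≥ 0` (outward mean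
curvatures; NO symmetry anywhere), then after Bär–Hanke normal forms with parameters `+λ` on `W₁, W₂` and `−λ`
on `M` and on a second copy `W₁'` of `W₁`, the four closed PSC manifolds `W₁∪M = S⁴`, `W₂∪M = Σ`, `W₂∪W₁' ≅ S⁴`,
`W₁∪W₁' = D(W₁) ≅ S⁴` all contain `Y` with the SAME two-sided collar metric, and the Gromov–Lawson sums
`(W₁∪M) # (W₂∪W₁') = (W₁♮W₂) ∪ (M♮W₁')` and `(W₂∪M) # (W₁∪W₁') = (W₂♮W₁) ∪ (M♮W₁')`, performed with one recipe
at one seam point, carry PSC metrics for which the exchange of the two (isometric) collar-and-neck regions is an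
ISOMETRIC INVOLUTION `T` near the new seam `Y # Y`, side-preserving, inducing the swap `τ`: exactly the
`(jC, jW, g, U, T)` datum that the landed stubs 3, 4 of line `birth` turn into `CorkRegluablePsc`.  The τ-symmetry
that line `birth`'s stuck stub 2A must impose on ONE cork (τ-invariant `h`, two inequalities coupled through `τ`)
is here MANUFACTURED by the swap; what remains (stub `stub_crossFilling`) is a symmetry-free statement about three
fillings of one boundary metric.

Registered stubs: `stub_kmThm31Four`, `stub_piStableFour`, `stub_matveyevH4`, `stub_bh27` (named facts of the tree,
shared verbatim with line `birth`), `stub_crossFilling` (THE BET), `stub_swapSum` (the metrised boundary-sum swap).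
Sorry-free: `stub_thetaFour`, `matveyevPartOneFact`, `symmetricGermOnSphere_of_stubs`, `CorkRegluablePsc_of`
(concludes `Summit.SmoothPoincare4.SmoothPoincare4.Theses.WeylBudget.CorkRegluablePsc` BY NAME, through the LANDED
`…Theorems.stub_transportSymmetricGerm` (p155387), `…Theorems.stub_isometricRegluing` (p149812),
`…Theorems.stub_isometricTransport` (p147438)).

References: [Matveyev1996] Thm. 1, proof pp. 1–3, Fact 1 and fig. 2; [KirbyCorks1996] Addendum (D);
[BarHanke2023] §3 Thm. 27, Prop. 28, §4.4 Thm. 42; [GromovLawsonAnnals1980] connected-sum lemma;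
[ShiWangWei2022] Thm. 1.1–1.2; Cecchini–Hirsch–Zeidler 2024 (arXiv:2404.17533) Thm. 1.2–1.3;
[Sweeney2026] Prop. 1.2; [KervaireMilnorAnnals1963] Θ₄ = 0.
-/

set_option linter.dupNamespace false

noncomputable section

open scoped Manifold ContDiff Topology

namespace Summit.SmoothPoincare4.SmoothPoincare4.Cruxes.CorkRegluablePsc.SwapSum

/-! ### Topological stubs (the tree's open leaves; verbatim the stubs of line `birth`) -/

/-- **Stub T1-i — Kervaire–Milnor Thm. 3.1 at `n = 4`** (every homotopy 4-sphere is s-parallelizable; the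
hypothesis `h31` of the tree's proved `isHCobordant_sphere_of_homotopySphere_four_of_frontier₄`).  Shared verbatim
with line `birth`.  Size XL (not a prover task of this line).
[cite: KervaireMilnorAnnals1963, §3, Thm. 3.1, Case 2 (p. 508)] [cite: Kosinski1993, Ch. IX, Thm. (8.5)] -/
theorem stub_kmThm31Four :
    ∀ S : Literature.Topology.FourManifolds.HomotopySphere 4,
      Literature.Topology.FourManifolds.IsStablyParallelizable (𝓡 4) S.carrier := by
  sorry

/-- **Stub T1-ii — `Π₄ = 0`** (named fact `Literature.Topology.FourManifolds.piStable_four_trivial`).  Shared verbatim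
with line `birth`.  Size XL. [cite: KervaireMilnorAnnals1963, §4, table p. 512 (Π₄ = 0)] -/
theorem stub_piStableFour : Literature.Topology.FourManifolds.piStable_four_trivial := by
  sorry

/-- **`Θ₄ = 0` (derived, sorry-free over T1-i, T1-ii)** by the tree's proved Kervaire–Milnor chain, exactly as in
line `birth`. [cite: KervaireMilnorAnnals1963, table p. 504 (Θ₄ = 0)] -/
theorem stub_thetaFour :
    Literature.Topology.FourManifolds.isHCobordant_sphere_of_homotopySphere_four :=
  Literature.Topology.FourManifolds.isHCobordant_sphere_of_homotopySphere_four_of_frontier₄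
    stub_kmThm31Four
    Literature.Topology.FourManifolds.boundsParallelizable_of_collapseNullHomotopic_holds
    stub_piStableFour
    Literature.Topology.FourManifolds.HomotopySphere.boundsContractible_of_nullCobordism_isStablyParallelizable_four_holds

/-- **Stub T2 — (H4) Matveyev's Theorem part 1 with Fact 1 from the middle level on** (named fact
`Literature.Topology.FourManifolds.Matveyev1996_partOne_and_fact_of_dualSpheres`, universe 0).  Shared verbatim
with line `birth`.  Size XL. [cite: Matveyev1996, proof of Theorem pp. 1–2, Fact 1 p. 3]
[cite: KirbyCorks1996, §3 and §4 Addenda (B), (C)] -/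
theorem stub_matveyevH4 :
    Literature.Topology.FourManifolds.Matveyev1996_partOne_and_fact_of_dualSpheres.{0} := by
  sorry

/-- **Matveyev form (derived, sorry-free over T2)**: `Matveyev1996_partOne_and_fact` — for h-cobordant simply
connected closed `X₁, X₂`: `X₁ = W₁ ∪_{φ₁} M`, `X₂ = W₂ ∪_{φ₂} M`, `Wᵢ` compact contractible, `M` compact,
`D(W₁) = S⁴ = W₁ ∪_{φ₁φ₂⁻¹} W₂` — by the tree's `matveyev1996_partOne_and_fact_of_dualSpheres` (rung (B) discharged).
[cite: Matveyev1996, Theorem 1 part 1 and Fact 1 (pp. 1–3)] -/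
theorem matveyevPartOneFact :
    Literature.Topology.FourManifolds.Matveyev1996_partOne_and_fact.{0} :=
  Literature.Topology.FourManifolds.matveyev1996_partOne_and_fact_of_dualSpheres stub_matveyevH4

/-! ### Stub A — THE BET: cross-filling of one boundary metric by the Matveyev triple (no symmetry) -/

/-- **Stub A — `stub_crossFilling` (THE BET of this line; scalar curvature with boundary, L / open).**
For a MATVEYEV TRIPLE — compact contractible `W₁, W₂` and compact `M`, smooth 4-manifolds with boundary data
`b₁, b₂, bM`, identifications `φ₁ : ∂W₁ ≅ ∂M`, `φ₂ : ∂W₂ ≅ ∂M`, with `W₁ ∪_{φ₁} M = S⁴`, `D(W₁) = S⁴` and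
`W₁ ∪_{φ₁φ₂⁻¹} W₂ = S⁴` (so BOTH corks are pieces of the standard sphere) — there are Riemannian PSC metrics
`g₁, g₂, g_M` on the THREE pieces, with smooth outward unit normals, inducing ONE boundary metric
(`b₁.incl^* g₁ = (bM.incl ∘ φ₁)^* g_M`, `b₂.incl^* g₂ = (bM.incl ∘ φ₂)^* g_M`) and satisfying the four ONE-SIDED
sign conditions on outward mean curvatures (tree convention `H = tr K_ν`, unit ball `+3`):
(i) `H₁(z) + H_M(φ₁ z) ≥ 0`, (ii) `H₂(w) + H_M(φ₂ w) ≥ 0`, (iii) `H₁(z) + H₂(φ₂⁻¹φ₁ z) ≥ 0`, (iv) `H₁ ≥ 0`.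
NO involution, NO invariance: the symmetry of the crux is produced afterwards by `stub_swapSum`.
Why plausibly true: (i)+(iv) alone are free — any PSC metric on `S⁴ = W₁ ∪ M` in which `Y = ∂W₁` is weakly
mean-convex toward `W₁` (Lawson–Michelsohn surrounding / Sweeney 2026 Prop. 1.2 for Mazur-type `W₁`) restricts to
`g₁, g_M` with `H₁ = -H_M ≥ 0`; what remains is that the OTHER cork `W₂ ⊂ S⁴` PSC-fills the same Bartnik data at
least as convexly, `H₂ ≥ H₁` on `(Y, h)` ("cross-filling"); every known obstruction to NNSC/PSC fill-ins with
mean-curvature bounds (Shi–Tam, Shi–Wang–Wei 2022 Thm. 1.2, Gromov 2023, Cecchini–Hirsch–Zeidler 2024 Thms. 1.2–1.5)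
depends on `(Y, h, H)` and spin only, never on which contractible spin filling is used, and `(h, H₁)` IS filled by
the contractible spin `W₁`.  Why it might fail: PSC fill-in regions of Bartnik data might nevertheless detect the
exotic rel-boundary structure distinguishing `W₂` from `W₁` (a scalar-curvature cork detector — unknown either way;
cf. the retired route PscCorkFillIn, crux `CorkFillInInvariance`), and the mean-convex end of a fill-in region is
the rigid one (Miao's question; CHZ 2024 Thm. 1.2: some `(S³, h)` have NO mean-convex spin NNSC fill-in at all).
[cite: ShiWangWei2022, Thm. 1.1, Thm. 1.2] [cite: BarHanke2023, §4.4 Thm. 42, Rem. 37]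
[cite: Sweeney2026, Prop. 1.2] [cite: Matveyev1996, Fact 1 (p. 3)] -/
theorem stub_crossFilling :
    ∀ (W₁ : Type) [TopologicalSpace W₁] [T2Space W₁] [SecondCountableTopology W₁]
    [ChartedSpace (EuclideanHalfSpace 4) W₁] [IsManifold (𝓡∂ 4) ∞ W₁] [CompactSpace W₁] [ContractibleSpace W₁]
    (b₁ : Literature.Topology.FourManifolds.BoundaryData (𝓡∂ 4) W₁ (𝓡 3))
    (W₂ : Type) [TopologicalSpace W₂] [T2Space W₂] [SecondCountableTopology W₂]
    [ChartedSpace (EuclideanHalfSpace 4) W₂] [IsManifold (𝓡∂ 4) ∞ W₂] [CompactSpace W₂] [ContractibleSpace W₂]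
    (b₂ : Literature.Topology.FourManifolds.BoundaryData (𝓡∂ 4) W₂ (𝓡 3))
    (M : Type) [TopologicalSpace M] [T2Space M] [SecondCountableTopology M]
    [ChartedSpace (EuclideanHalfSpace 4) M] [IsManifold (𝓡∂ 4) ∞ M] [CompactSpace M]
    (bM : Literature.Topology.FourManifolds.BoundaryData (𝓡∂ 4) M (𝓡 3))
    (φ₁ : b₁.carrier ≃ₘ⟮𝓡 3, 𝓡 3⟯ bM.carrier) (φ₂ : b₂.carrier ≃ₘ⟮𝓡 3, 𝓡 3⟯ bM.carrier),
    Literature.Topology.FourManifolds.IsBoundaryGluing b₁ bM φ₁ (𝓡 4) (Metric.sphere (0 : EuclideanSpace ℝ (Fin 5)) 1) →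
    Literature.Topology.FourManifolds.IsDouble b₁ (𝓡 4) (Metric.sphere (0 : EuclideanSpace ℝ (Fin 5)) 1) →
    Literature.Topology.FourManifolds.IsBoundaryGluing b₁ b₂ (φ₁.trans φ₂.symm) (𝓡 4) (Metric.sphere (0 : EuclideanSpace ℝ (Fin 5)) 1) →
    ∃ (g₁ : Literature.Geometry.Lorentzian.PseudoRiemannianMetric (𝓡∂ 4) ∞ (EuclideanSpace ℝ (Fin 4)) (TangentSpace (𝓡∂ 4) : W₁ → Type _))
    (_ : g₁.HasLeviCivita) (hf₁ : g₁.IsSpacelikeImmersion (𝓡 3) b₁.incl)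
    (ν₁ : Literature.Geometry.Lorentzian.NormalField (𝓡∂ 4) b₁.incl)
    (g₂ : Literature.Geometry.Lorentzian.PseudoRiemannianMetric (𝓡∂ 4) ∞ (EuclideanSpace ℝ (Fin 4)) (TangentSpace (𝓡∂ 4) : W₂ → Type _))
    (_ : g₂.HasLeviCivita) (hf₂ : g₂.IsSpacelikeImmersion (𝓡 3) b₂.incl)
    (ν₂ : Literature.Geometry.Lorentzian.NormalField (𝓡∂ 4) b₂.incl)
    (gM : Literature.Geometry.Lorentzian.PseudoRiemannianMetric (𝓡∂ 4) ∞ (EuclideanSpace ℝ (Fin 4)) (TangentSpace (𝓡∂ 4) : M → Type _))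
    (_ : gM.HasLeviCivita) (hfM : gM.IsSpacelikeImmersion (𝓡 3) bM.incl)
    (νM : Literature.Geometry.Lorentzian.NormalField (𝓡∂ 4) bM.incl),
    (g₁.IsRiemannian ∧ (∀ x, 0 < g₁.scalarCurvature x) ∧ g₁.IsUnitNormal (𝓡 3) b₁.incl ν₁ 1 ∧
      ContMDiff (𝓡 3) (𝓡∂ 4).tangent ∞ (fun z ↦ (Bundle.TotalSpace.mk' (EuclideanSpace ℝ (Fin 4)) (b₁.incl z) (ν₁ z) : TangentBundle (𝓡∂ 4) W₁)) ∧
      (∀ z, (show EuclideanSpace ℝ (Fin 4) from ν₁ z) 0 < 0)) ∧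
    (g₂.IsRiemannian ∧ (∀ x, 0 < g₂.scalarCurvature x) ∧ g₂.IsUnitNormal (𝓡 3) b₂.incl ν₂ 1 ∧
      ContMDiff (𝓡 3) (𝓡∂ 4).tangent ∞ (fun w ↦ (Bundle.TotalSpace.mk' (EuclideanSpace ℝ (Fin 4)) (b₂.incl w) (ν₂ w) : TangentBundle (𝓡∂ 4) W₂)) ∧
      (∀ w, (show EuclideanSpace ℝ (Fin 4) from ν₂ w) 0 < 0)) ∧
    (gM.IsRiemannian ∧ (∀ x, 0 < gM.scalarCurvature x) ∧ gM.IsUnitNormal (𝓡 3) bM.incl νM 1 ∧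
      ContMDiff (𝓡 3) (𝓡∂ 4).tangent ∞ (fun m ↦ (Bundle.TotalSpace.mk' (EuclideanSpace ℝ (Fin 4)) (bM.incl m) (νM m) : TangentBundle (𝓡∂ 4) M)) ∧
      (∀ m, (show EuclideanSpace ℝ (Fin 4) from νM m) 0 < 0)) ∧
    (∀ z, Literature.Geometry.Lorentzian.pullbackBilin (I := 𝓡∂ 4) (I' := 𝓡 3) b₁.incl g₁.val z =
      Literature.Geometry.Lorentzian.pullbackBilin (I := 𝓡∂ 4) (I' := 𝓡 3) (bM.incl ∘ φ₁) gM.val z) ∧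
    (∀ w, Literature.Geometry.Lorentzian.pullbackBilin (I := 𝓡∂ 4) (I' := 𝓡 3) b₂.incl g₂.val w =
      Literature.Geometry.Lorentzian.pullbackBilin (I := 𝓡∂ 4) (I' := 𝓡 3) (bM.incl ∘ φ₂) gM.val w) ∧
    (∀ z, 0 ≤ g₁.meanCurvature b₁.incl Literature.Geometry.Lorentzian.PseudoRiemannianMetric.contMDiff_pullbackBilin_holds hf₁ ν₁ z +
      gM.meanCurvature bM.incl Literature.Geometry.Lorentzian.PseudoRiemannianMetric.contMDiff_pullbackBilin_holds hfM νM (φ₁ z)) ∧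
    (∀ w, 0 ≤ g₂.meanCurvature b₂.incl Literature.Geometry.Lorentzian.PseudoRiemannianMetric.contMDiff_pullbackBilin_holds hf₂ ν₂ w +
      gM.meanCurvature bM.incl Literature.Geometry.Lorentzian.PseudoRiemannianMetric.contMDiff_pullbackBilin_holds hfM νM (φ₂ w)) ∧
    (∀ z, 0 ≤ g₁.meanCurvature b₁.incl Literature.Geometry.Lorentzian.PseudoRiemannianMetric.contMDiff_pullbackBilin_holds hf₁ ν₁ z +
      g₂.meanCurvature b₂.incl Literature.Geometry.Lorentzian.PseudoRiemannianMetric.contMDiff_pullbackBilin_holds hf₂ ν₂ (φ₂.symm (φ₁ z))) ∧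
    (∀ z, 0 ≤ g₁.meanCurvature b₁.incl Literature.Geometry.Lorentzian.PseudoRiemannianMetric.contMDiff_pullbackBilin_holds hf₁ ν₁ z) := by
  sorry

/-! ### Stub B — Bär–Hanke Thm. 27 (named fact, shared with line `birth`) -/

/-- **Stub B — Bär–Hanke 2023, Thm. 27, umbilic C-normal form — NO LONGER A STUB** (the named fact
`Literature.Geometry.Riemannian.BarHanke2023_thm27_umbilicNormalForm`, vendored p155406, is DISCHARGED in the tree:
`BarHanke2023_thm27_umbilicNormalForm_holds`, `BaerHankeNormalFormProofs.lean`; Prop. 28 likewise,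
`BarHanke2023_prop28_meanCurvatureIncrease_holds`).  Kept under its stub name so that line `birth` closes the same leaf verbatim.
[cite: BarHanke2023, §3 Thm. 27, Def. 21] -/
theorem stub_bh27 : Literature.Geometry.Riemannian.BarHanke2023_thm27_umbilicNormalForm :=
  -- CLOSED (lead c3, 2026-08-17): the named fact is discharged in the tree
  -- (`BaerHankeNormalFormProofs.lean`, from Bär–Hanke Props. 23, 26 via the cylinder deformation core).
  Literature.Geometry.Riemannian.BarHanke2023_thm27_umbilicNormalForm_holds

/-! ### Stub C — the metrised boundary-sum swap -/

/-- **Stub C — `stub_swapSum` (Matveyev's `♮`-swap carried out WITH METRICS; differential topology + Bär–Hanke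
normal forms + the Gromov–Lawson connected-sum lemma; XL but every step standard).**  Given Bär–Hanke Thm. 27 and
Prop. 28, a Matveyev triple `(W₁, W₂, M; φ₁, φ₂)` of `S⁴` as in `stub_crossFilling`, cross-filling metrics
`g₁, g₂, g_M` with (i)–(iv), and a homotopy 4-sphere `Σ = W₂ ∪_{φ₂} M`: there is an INVOLUTIVE CORK PRESENTATION
`S⁴ = C ∪_φ W`, `Σ = C ∪_(φ∘τ) W` (`C` compact contractible, `W` compact, `τ` an involution of `∂C`) together with a
gluing `P = C ∪_φ W` (piece embeddings `jC, jW`) carrying a Riemannian PSC metric `g`, an open `U ⊇ jC(∂C)` and a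
smooth involution `T` of `U` which is `g`-isometric, side-preserving and induces `τ` on the seam — the conclusion of
line `birth`'s stub 2B, for a presentation CHOSEN here.  Construction: (1) Prop. 28 makes (i)–(iv) strict; choose a
smooth `λ : Y → ℝ` with `max(-H_M∘φ₁, -H₁) < 3λ < min(H₁, H₂∘φ₂⁻¹φ₁)` (possible iff (i)–(iv)); Thm. 27 deforms,
keeping `h` and `scal > 0`, `g₁ ↦ g₁⁺` and `g₂ ↦ g₂⁺` to collar normal form `dt² + (1 - 2λt - Ct²)h` and
`g_M ↦ g_M⁻`, a second copy `g₁ ↦ g₁'⁻` to `dt² + (1 + 2λt - Ct²)h`; (2) the four closed manifolds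
`A = W₁⁺ ∪ M⁻ = S⁴`, `B = W₂⁺ ∪ M⁻ = Σ`, `A' = W₂⁺ ∪ W₁'⁻ ≅ S⁴`, `B' = W₁⁺ ∪ W₁'⁻ = D(W₁) ≅ S⁴` are smooth PSC
and contain `Y` with the IDENTICAL two-sided collar `dr² + (1 + 2λr - Cr²)h`; (3) Gromov–Lawson connected sums
`A # A'` and `B # B'` at the seam point `(y₀, 0)` with one recipe (identical metric balls ⇒ identical necks), the
neck ends identified through a reflection `s` of the round `S³(ρ)` in a direction tangent to `Y`: then
`A # A' = (W₁⁺ ♮ W₂⁺) ∪ (M⁻ ♮ W₁'⁻) =: C ∪_φ W ≅ S⁴ # S⁴ ≅ S⁴` and `B # B' = (W₂⁺ ♮ W₁⁺) ∪ (M⁻ ♮ W₁'⁻) ≅ Σ # S⁴ ≅ Σ`,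
the exchange of the two isometric collar-and-half-neck regions, `(x, t) ↦ (s x, -t)` on the neck, is a smooth
isometric involution `T` of a neighbourhood `U` of the new seam `Y # Y`, preserving it and its sides, and
`τ := T|seam` (Kirby's involution) satisfies `B # B' = C ∪_(φ∘τ) W`; `C = W₁ ♮ W₂` is compact contractible.  The
purely topological half (seam-adapted boundary sums, `X # S⁴ ≅ X`, gluing uniqueness) is the tree's proof of
`Matveyev1996_partOne_and_fact.matveyev1996_decomposition` (`CorkDecompositionMatveyevForm.lean`).  Why it might
fail: only through a bookkeeping slip (sides/orientation of the neck identification) — each ingredient is a theorem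
in print.  [cite: Matveyev1996, proof of part 2, p. 3 and fig. 2] [cite: KirbyCorks1996, Addendum (D)]
[cite: BarHanke2023, §3 Thm. 27, Prop. 28, Def. 21] [cite: GromovLawsonAnnals1980, connected-sum construction]
[cite: HirschDT1976, Ch. 8 §2 Thm. 2.1] -/
theorem stub_swapSum :
    Literature.Geometry.Riemannian.BarHanke2023_thm27_umbilicNormalForm →
    Literature.Geometry.Riemannian.BarHanke2023_prop28_meanCurvatureIncrease →
    ∀ (W₁ : Type) [TopologicalSpace W₁] [T2Space W₁] [SecondCountableTopology W₁]
    [ChartedSpace (EuclideanHalfSpace 4) W₁] [IsManifold (𝓡∂ 4) ∞ W₁] [CompactSpace W₁] [ContractibleSpace W₁]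
    (b₁ : Literature.Topology.FourManifolds.BoundaryData (𝓡∂ 4) W₁ (𝓡 3))
    (W₂ : Type) [TopologicalSpace W₂] [T2Space W₂] [SecondCountableTopology W₂]
    [ChartedSpace (EuclideanHalfSpace 4) W₂] [IsManifold (𝓡∂ 4) ∞ W₂] [CompactSpace W₂] [ContractibleSpace W₂]
    (b₂ : Literature.Topology.FourManifolds.BoundaryData (𝓡∂ 4) W₂ (𝓡 3))
    (M : Type) [TopologicalSpace M] [T2Space M] [SecondCountableTopology M]
    [ChartedSpace (EuclideanHalfSpace 4) M] [IsManifold (𝓡∂ 4) ∞ M] [CompactSpace M]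
    (bM : Literature.Topology.FourManifolds.BoundaryData (𝓡∂ 4) M (𝓡 3))
    (φ₁ : b₁.carrier ≃ₘ⟮𝓡 3, 𝓡 3⟯ bM.carrier) (φ₂ : b₂.carrier ≃ₘ⟮𝓡 3, 𝓡 3⟯ bM.carrier),
    Literature.Topology.FourManifolds.IsBoundaryGluing b₁ bM φ₁ (𝓡 4) (Metric.sphere (0 : EuclideanSpace ℝ (Fin 5)) 1) →
    Literature.Topology.FourManifolds.IsDouble b₁ (𝓡 4) (Metric.sphere (0 : EuclideanSpace ℝ (Fin 5)) 1) →
    Literature.Topology.FourManifolds.IsBoundaryGluing b₁ b₂ (φ₁.trans φ₂.symm) (𝓡 4) (Metric.sphere (0 : EuclideanSpace ℝ (Fin 5)) 1) →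
    ∀ (g₁ : Literature.Geometry.Lorentzian.PseudoRiemannianMetric (𝓡∂ 4) ∞ (EuclideanSpace ℝ (Fin 4)) (TangentSpace (𝓡∂ 4) : W₁ → Type _))
    [g₁.HasLeviCivita] (hf₁ : g₁.IsSpacelikeImmersion (𝓡 3) b₁.incl)
    (ν₁ : Literature.Geometry.Lorentzian.NormalField (𝓡∂ 4) b₁.incl)
    (g₂ : Literature.Geometry.Lorentzian.PseudoRiemannianMetric (𝓡∂ 4) ∞ (EuclideanSpace ℝ (Fin 4)) (TangentSpace (𝓡∂ 4) : W₂ → Type _))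
    [g₂.HasLeviCivita] (hf₂ : g₂.IsSpacelikeImmersion (𝓡 3) b₂.incl)
    (ν₂ : Literature.Geometry.Lorentzian.NormalField (𝓡∂ 4) b₂.incl)
    (gM : Literature.Geometry.Lorentzian.PseudoRiemannianMetric (𝓡∂ 4) ∞ (EuclideanSpace ℝ (Fin 4)) (TangentSpace (𝓡∂ 4) : M → Type _))
    [gM.HasLeviCivita] (hfM : gM.IsSpacelikeImmersion (𝓡 3) bM.incl)
    (νM : Literature.Geometry.Lorentzian.NormalField (𝓡∂ 4) bM.incl),
    (g₁.IsRiemannian ∧ (∀ x, 0 < g₁.scalarCurvature x) ∧ g₁.IsUnitNormal (𝓡 3) b₁.incl ν₁ 1 ∧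
      ContMDiff (𝓡 3) (𝓡∂ 4).tangent ∞ (fun z ↦ (Bundle.TotalSpace.mk' (EuclideanSpace ℝ (Fin 4)) (b₁.incl z) (ν₁ z) : TangentBundle (𝓡∂ 4) W₁)) ∧
      (∀ z, (show EuclideanSpace ℝ (Fin 4) from ν₁ z) 0 < 0)) →
    (g₂.IsRiemannian ∧ (∀ x, 0 < g₂.scalarCurvature x) ∧ g₂.IsUnitNormal (𝓡 3) b₂.incl ν₂ 1 ∧
      ContMDiff (𝓡 3) (𝓡∂ 4).tangent ∞ (fun w ↦ (Bundle.TotalSpace.mk' (EuclideanSpace ℝ (Fin 4)) (b₂.incl w) (ν₂ w) : TangentBundle (𝓡∂ 4) W₂)) ∧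
      (∀ w, (show EuclideanSpace ℝ (Fin 4) from ν₂ w) 0 < 0)) →
    (gM.IsRiemannian ∧ (∀ x, 0 < gM.scalarCurvature x) ∧ gM.IsUnitNormal (𝓡 3) bM.incl νM 1 ∧
      ContMDiff (𝓡 3) (𝓡∂ 4).tangent ∞ (fun m ↦ (Bundle.TotalSpace.mk' (EuclideanSpace ℝ (Fin 4)) (bM.incl m) (νM m) : TangentBundle (𝓡∂ 4) M)) ∧
      (∀ m, (show EuclideanSpace ℝ (Fin 4) from νM m) 0 < 0)) →
    (∀ z, Literature.Geometry.Lorentzian.pullbackBilin (I := 𝓡∂ 4) (I' := 𝓡 3) b₁.incl g₁.val z =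
      Literature.Geometry.Lorentzian.pullbackBilin (I := 𝓡∂ 4) (I' := 𝓡 3) (bM.incl ∘ φ₁) gM.val z) →
    (∀ w, Literature.Geometry.Lorentzian.pullbackBilin (I := 𝓡∂ 4) (I' := 𝓡 3) b₂.incl g₂.val w =
      Literature.Geometry.Lorentzian.pullbackBilin (I := 𝓡∂ 4) (I' := 𝓡 3) (bM.incl ∘ φ₂) gM.val w) →
    (∀ z, 0 ≤ g₁.meanCurvature b₁.incl Literature.Geometry.Lorentzian.PseudoRiemannianMetric.contMDiff_pullbackBilin_holds hf₁ ν₁ z +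
      gM.meanCurvature bM.incl Literature.Geometry.Lorentzian.PseudoRiemannianMetric.contMDiff_pullbackBilin_holds hfM νM (φ₁ z)) →
    (∀ w, 0 ≤ g₂.meanCurvature b₂.incl Literature.Geometry.Lorentzian.PseudoRiemannianMetric.contMDiff_pullbackBilin_holds hf₂ ν₂ w +
      gM.meanCurvature bM.incl Literature.Geometry.Lorentzian.PseudoRiemannianMetric.contMDiff_pullbackBilin_holds hfM νM (φ₂ w)) →
    (∀ z, 0 ≤ g₁.meanCurvature b₁.incl Literature.Geometry.Lorentzian.PseudoRiemannianMetric.contMDiff_pullbackBilin_holds hf₁ ν₁ z +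
      g₂.meanCurvature b₂.incl Literature.Geometry.Lorentzian.PseudoRiemannianMetric.contMDiff_pullbackBilin_holds hf₂ ν₂ (φ₂.symm (φ₁ z))) →
    (∀ z, 0 ≤ g₁.meanCurvature b₁.incl Literature.Geometry.Lorentzian.PseudoRiemannianMetric.contMDiff_pullbackBilin_holds hf₁ ν₁ z) →
    ∀ S : Literature.Topology.FourManifolds.HomotopySphere 4,
      Literature.Topology.FourManifolds.IsBoundaryGluing b₂ bM φ₂ (𝓡 4) S.carrier →
    ∃ (C : Type) (_ : TopologicalSpace C) (_ : T2Space C) (_ : SecondCountableTopology C)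
      (_ : ChartedSpace (EuclideanHalfSpace 4) C) (_ : IsManifold (𝓡∂ 4) ∞ C) (_ : CompactSpace C) (_ : ContractibleSpace C)
      (bC : Literature.Topology.FourManifolds.BoundaryData (𝓡∂ 4) C (𝓡 3))
      (W : Type) (_ : TopologicalSpace W) (_ : T2Space W) (_ : SecondCountableTopology W)
      (_ : ChartedSpace (EuclideanHalfSpace 4) W) (_ : IsManifold (𝓡∂ 4) ∞ W) (_ : CompactSpace W)
      (bW : Literature.Topology.FourManifolds.BoundaryData (𝓡∂ 4) W (𝓡 3))
      (φ : bC.carrier ≃ₘ⟮𝓡 3, 𝓡 3⟯ bW.carrier) (τ : bC.carrier ≃ₘ⟮𝓡 3, 𝓡 3⟯ bC.carrier),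
    Function.Involutive τ ∧
    Literature.Topology.FourManifolds.IsBoundaryGluing bC bW φ (𝓡 4) (Metric.sphere (0 : EuclideanSpace ℝ (Fin 5)) 1) ∧
    Literature.Topology.FourManifolds.IsBoundaryGluing bC bW (τ.trans φ) (𝓡 4) S.carrier ∧
    ∃ (P : Type) (_ : TopologicalSpace P) (_ : T2Space P) (_ : SecondCountableTopology P)
    (_ : ChartedSpace (EuclideanSpace ℝ (Fin 4)) P) (_ : IsManifold (𝓡 4) ∞ P),
    ∃ (jC : C → P) (jW : W → P),
    (Manifold.IsSmoothEmbedding (𝓡∂ 4) (𝓡 4) ∞ jC ∧ Manifold.IsSmoothEmbedding (𝓡∂ 4) (𝓡 4) ∞ jW ∧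
      Set.range jC ∪ Set.range jW = Set.univ ∧
      (∀ a b, jC a = jW b ↔ ∃ z, a = bC.incl z ∧ b = bW.incl (φ z))) ∧
    ∃ (g : Literature.Geometry.Lorentzian.PseudoRiemannianMetric (𝓡 4) ∞ (EuclideanSpace ℝ (Fin 4)) (TangentSpace (𝓡 4) : P → Type _))
    (U : Set P) (T : P → P),
      g.IsRiemannian ∧ (∃ _ : g.HasLeviCivita, ∀ x, 0 < g.scalarCurvature x) ∧
      IsOpen U ∧ (∀ z, jC (bC.incl z) ∈ U) ∧ ContMDiffOn (𝓡 4) (𝓡 4) ∞ T U ∧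
      (∀ x ∈ U, T x ∈ U) ∧ (∀ x ∈ U, T (T x) = x) ∧
      (∀ x ∈ U, (T x ∈ Set.range jC ↔ x ∈ Set.range jC)) ∧
      (∀ z, T (jC (bC.incl z)) = jC (bC.incl (τ z))) ∧
      (∀ x ∈ U, Literature.Geometry.Lorentzian.pullbackBilin (I := 𝓡 4) (I' := 𝓡 4) T g.val x = g.val x) := by
  sorry

/-! ### Composition (sorry-free) -/

/-- **Derived — involutive presentation with a τ-symmetric PSC germ ON THE STANDARD SPHERE, for every `Σ`.**
`Θ₄ = 0` (`stub_thetaFour`) makes `Σ` h-cobordant to `S⁴`; `matveyevPartOneFact` gives the Matveyev triple;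
`stub_crossFilling` the three metrics; `stub_swapSum` (fed with `stub_bh27` and the discharged Prop. 28) the
presentation and the germ on an abstract gluing `P`; the LANDED `…Theorems.stub_transportSymmetricGerm` moves it to
`S⁴` along gluing uniqueness. [folklore] -/
theorem symmetricGermOnSphere_of_stubs (S : Literature.Topology.FourManifolds.HomotopySphere 4) :
    ∃ (C : Type) (_ : TopologicalSpace C) (_ : T2Space C) (_ : SecondCountableTopology C)
      (_ : ChartedSpace (EuclideanHalfSpace 4) C) (_ : IsManifold (𝓡∂ 4) ∞ C) (_ : CompactSpace C) (_ : ContractibleSpace C)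
      (bC : Literature.Topology.FourManifolds.BoundaryData (𝓡∂ 4) C (𝓡 3))
      (W : Type) (_ : TopologicalSpace W) (_ : T2Space W) (_ : SecondCountableTopology W)
      (_ : ChartedSpace (EuclideanHalfSpace 4) W) (_ : IsManifold (𝓡∂ 4) ∞ W) (_ : CompactSpace W)
      (bW : Literature.Topology.FourManifolds.BoundaryData (𝓡∂ 4) W (𝓡 3))
      (φ : bC.carrier ≃ₘ⟮𝓡 3, 𝓡 3⟯ bW.carrier) (τ : bC.carrier ≃ₘ⟮𝓡 3, 𝓡 3⟯ bC.carrier),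
    Function.Involutive τ ∧
    Literature.Topology.FourManifolds.IsBoundaryGluing bC bW φ (𝓡 4) (Metric.sphere (0 : EuclideanSpace ℝ (Fin 5)) 1) ∧
    Literature.Topology.FourManifolds.IsBoundaryGluing bC bW (τ.trans φ) (𝓡 4) S.carrier ∧
    ∃ (jC : C → (Metric.sphere (0 : EuclideanSpace ℝ (Fin 5)) 1)) (jW : W → (Metric.sphere (0 : EuclideanSpace ℝ (Fin 5)) 1)),
    (Manifold.IsSmoothEmbedding (𝓡∂ 4) (𝓡 4) ∞ jC ∧ Manifold.IsSmoothEmbedding (𝓡∂ 4) (𝓡 4) ∞ jW ∧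
      Set.range jC ∪ Set.range jW = Set.univ ∧
      (∀ a b, jC a = jW b ↔ ∃ z, a = bC.incl z ∧ b = bW.incl (φ z))) ∧
    ∃ (g : Literature.Geometry.Lorentzian.PseudoRiemannianMetric (𝓡 4) ∞ (EuclideanSpace ℝ (Fin 4)) (TangentSpace (𝓡 4) : (Metric.sphere (0 : EuclideanSpace ℝ (Fin 5)) 1) → Type _))
    (U : Set (Metric.sphere (0 : EuclideanSpace ℝ (Fin 5)) 1)) (T : (Metric.sphere (0 : EuclideanSpace ℝ (Fin 5)) 1) → (Metric.sphere (0 : EuclideanSpace ℝ (Fin 5)) 1)),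
      g.IsRiemannian ∧ (∃ _ : g.HasLeviCivita, ∀ x, 0 < g.scalarCurvature x) ∧
      IsOpen U ∧ (∀ z, jC (bC.incl z) ∈ U) ∧ ContMDiffOn (𝓡 4) (𝓡 4) ∞ T U ∧
      (∀ x ∈ U, T x ∈ U) ∧ (∀ x ∈ U, T (T x) = x) ∧
      (∀ x ∈ U, (T x ∈ Set.range jC ↔ x ∈ Set.range jC)) ∧
      (∀ z, T (jC (bC.incl z)) = jC (bC.incl (τ z))) ∧
      (∀ x ∈ U, Literature.Geometry.Lorentzian.pullbackBilin (I := 𝓡 4) (I' := 𝓡 4) T g.val x = g.val x) := by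
  -- `Σ` is simply connected and h-cobordant to `S⁴`
  obtain ⟨e⟩ := S.nonempty_homotopyEquiv
  haveI : SimplyConnectedSpace (Metric.sphere (0 : EuclideanSpace ℝ (Fin 5)) 1) :=
    Literature.Topology.FourManifolds.simplyConnectedSpace_sphere_four_holds
  haveI : SimplyConnectedSpace S.carrier := e.simplyConnectedSpace
  have hcob : Literature.Topology.FourManifolds.IsHCobordant 4 (Metric.sphere (0 : EuclideanSpace ℝ (Fin 5)) 1) S.carrier :=
    (stub_thetaFour S).symm
  -- the Matveyev triple of `(S⁴, Σ)`
  obtain ⟨W₁, W₂, M, _, _, _, _, _, _, _, _, _, _, _, _, _, _, _, b₁, b₂, bM, φ₁, φ₂, hc₁, hk₁, hc₂, hk₂,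
    hcM, hX₁, hX₂, hD, hA⟩ := matveyevPartOneFact (Metric.sphere (0 : EuclideanSpace ℝ (Fin 5)) 1) S.carrier hcob
  -- the three cross-filling metrics (stub A)
  obtain ⟨g₁, hL₁, hf₁, ν₁, g₂, hL₂, hf₂, ν₂, gM, hLM, hfM, νM, hb₁, hb₂, hbM, hm₁, hm₂, hi, hii, hiii, hiv⟩ :=
    stub_crossFilling W₁ b₁ W₂ b₂ M bM φ₁ φ₂ hX₁ hD hA
  -- the metrised swap (stub C), fed with Bär–Hanke Thm. 27 (stub B) and the discharged Prop. 28
  obtain ⟨C, _, _, _, _, _, hcC, hkC, bC, W, _, _, _, _, _, hcW, bW, φ, τ, hτ, hS4, hSig, P, _, _, _, _, _,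
    jC, jW, hwit, g, U, T, hsym⟩ :=
    stub_swapSum stub_bh27 Literature.Geometry.Riemannian.BarHanke2023_prop28_meanCurvatureIncrease_holds
      W₁ b₁ W₂ b₂ M bM φ₁ φ₂ hX₁ hD hA g₁ hf₁ ν₁ g₂ hf₂ ν₂ gM hfM νM hb₁ hb₂ hbM hm₁ hm₂ hi hii hiii hiv
      S hX₂
  -- transport to the standard sphere (landed stub 2T of line `birth`)
  obtain ⟨jC', jW', hwit', g', U', T', hsym'⟩ :=
    _root_.Summit.SmoothPoincare4.SmoothPoincare4.Theorems.stub_transportSymmetricGerm C bC W bW φ τ P jC jW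
      g U T hτ hwit hsym hS4
  exact ⟨C, ‹_›, ‹_›, ‹_›, ‹_›, ‹_›, hcC, hkC, bC, W, ‹_›, ‹_›, ‹_›, ‹_›, ‹_›, hcW, bW, φ, τ, hτ, hS4, hSig,
    jC', jW', hwit', g', U', T', hsym'⟩

/-- **THE SKELETON THEOREM: `WeylBudget.CorkRegluablePsc` BY NAME from the registered stubs** — the presentation
and the symmetric germ on `S⁴` from `symmetricGermOnSphere_of_stubs`, then the LANDED stub 3 (isometric regluing,
`…Theorems.stub_isometricRegluing`, p149812) and stub 4 (transport to `S.carrier`,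
`…Theorems.stub_isometricTransport`, p147438) of line `birth`, packaged as in `birth`'s
`corkRegluablePsc_of_stubSigs`.  `sorry` enters only through `stub_*`. [folklore] -/
theorem corkRegluablePsc_pointwise (S : Literature.Topology.FourManifolds.HomotopySphere 4) :
    ∃ (C : Type) (_ : TopologicalSpace C) (_ : ChartedSpace (EuclideanHalfSpace 4) C) (_ :
      IsManifold (𝓡∂ 4) ∞ C) (V : Type) (_ : TopologicalSpace V) (_ : ChartedSpace (EuclideanHalfSpace
      4) V) (_ : IsManifold (𝓡∂ 4) ∞ V) (jC : C → (Metric.sphere (0 : EuclideanSpace ℝ (Fin 5)) 1))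
      (jV : V → (Metric.sphere (0 : EuclideanSpace ℝ (Fin 5)) 1)) (kC : C → S.carrier) (kV : V →
      S.carrier) (g : Literature.Geometry.Lorentzian.PseudoRiemannianMetric (𝓡 4) ∞ (EuclideanSpace ℝ (Fin 4)) (TangentSpace (𝓡 4) : (Metric.sphere (0 : EuclideanSpace ℝ (Fin 5)) 1) → Type _)) (γ :
      Literature.Geometry.Lorentzian.PseudoRiemannianMetric (𝓡 4) ∞ (EuclideanSpace ℝ (Fin 4)) (TangentSpace (𝓡 4) : S.carrier → Type _)), CompactSpace C ∧ ContractibleSpace C ∧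
      Manifold.IsSmoothEmbedding (𝓡∂ 4) (𝓡 4) ∞ jC ∧ Manifold.IsSmoothEmbedding (𝓡∂ 4) (𝓡 4) ∞ jV ∧
      Set.range jC ∪ Set.range jV = Set.univ ∧ (∀ c v, jC c = jV v → c ∈ (𝓡∂ 4).boundary C) ∧
      Manifold.IsSmoothEmbedding (𝓡∂ 4) (𝓡 4) ∞ kC ∧ Manifold.IsSmoothEmbedding (𝓡∂ 4) (𝓡 4) ∞ kV ∧
      Set.range kC ∪ Set.range kV = Set.univ ∧ (∀ c v, kC c = kV v → c ∈ (𝓡∂ 4).boundary C) ∧ (∀ c,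
      Literature.Geometry.Lorentzian.pullbackBilin (I := 𝓡 4) (I' := 𝓡∂ 4) jC g.val c =
      Literature.Geometry.Lorentzian.pullbackBilin (I := 𝓡 4) (I' := 𝓡∂ 4) kC γ.val c) ∧ (∀ v,
      Literature.Geometry.Lorentzian.pullbackBilin (I := 𝓡 4) (I' := 𝓡∂ 4) jV g.val v =
      Literature.Geometry.Lorentzian.pullbackBilin (I := 𝓡 4) (I' := 𝓡∂ 4) kV γ.val v) ∧
      g.IsRiemannian ∧ γ.IsRiemannian ∧ ∃ _ : g.HasLeviCivita, (∀ x, 0 < g.scalarCurvature x) := by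
  obtain ⟨C, instTC, instT2C, instSCC, instChC, instMC, instCompC, instContrC, bC, W, instTW, instT2W,
    instSCW, instChW, instMW, instCompW, bW, φ, τ, hτ, hS4, hSig, jC, jW, ⟨hjC, hjW, hcov, hseam⟩, g, U, T, hg,
    hLCscal, hU, hYU, hT, hTU, hTT, hTside, hTτ, hTiso⟩ := symmetricGermOnSphere_of_stubs S
  -- stub 3 (landed): the isometric regluing `X = C ∪_(φ∘τ) W` of `(S⁴, g)`
  obtain ⟨X, instTX, instT2X, instSCX, instChX, instMX, kC₀, kW₀, γ₀, hkC₀, hkW₀, hcov₀, hseam₀, hγ₀,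
    hpC₀, hpW₀⟩ :=
    _root_.Summit.SmoothPoincare4.SmoothPoincare4.Theorems.stub_isometricRegluing C bC W bW φ τ jC jW g U T hτ
      hjC hjW hcov hseam hg hU hYU hT hTU hTT hTside hTτ hTiso
  -- stub 4 (landed): transport to the given carrier `S.carrier`
  obtain ⟨kC, kW, γ, hkC, hkW, hkcov, hkseam, hγ, hpC, hpW⟩ :=
    _root_.Summit.SmoothPoincare4.SmoothPoincare4.Theorems.stub_isometricTransport C bC W bW (τ.trans φ) X
      S.carrier kC₀ kW₀ γ₀ hkC₀ hkW₀ hcov₀ hseam₀ hγ₀ hSig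
  obtain ⟨hLC, hscal⟩ := hLCscal
  refine ⟨C, instTC, instChC, instMC, W, instTW, instChW, instMW, jC, jW, kC, kW, g, γ, instCompC,
    instContrC, hjC, hjW, hcov, ?_, hkC, hkW, hkcov, ?_, ?_, ?_, hg, hγ, hLC, hscal⟩
  · intro c v hcv
    obtain ⟨z, hz, -⟩ := (hseam c v).1 hcv
    have hb : bC.incl z ∈ (𝓡∂ 4).boundary C := by
      rw [← bC.range_incl]; exact Set.mem_range_self z
    rw [hz]; exact hb
  · intro c v hcv
    obtain ⟨z, hz, -⟩ := (hkseam c v).1 hcv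
    have hb : bC.incl z ∈ (𝓡∂ 4).boundary C := by
      rw [← bC.range_incl]; exact Set.mem_range_self z
    rw [hz]; exact hb
  · intro c
    exact (hpC₀ c).trans (hpC c).symm
  · intro w
    exact (hpW₀ w).trans (hpW w).symm

/-- **`WeylBudget.CorkRegluablePsc` BY NAME** (`ledger skeleton check` shape: no hypotheses). [folklore] -/
theorem CorkRegluablePsc_of :
    Summit.SmoothPoincare4.SmoothPoincare4.Theses.WeylBudget.CorkRegluablePsc := by
  intro S
  exact corkRegluablePsc_pointwise S

end Summit.SmoothPoincare4.SmoothPoincare4.Cruxes.CorkRegluablePsc.SwapSum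

end
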